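import Literature.NumberTheory.DiophantineGeometry.AbcWave0GranvilleStarkHeightProofs
import Literature.NumberTheory.DiophantineGeometry.AbcWave0GranvilleStarkTheorem1Proofs
import Literature.NumberTheory.DiophantineGeometry.AbcWave0SiegelZerosProofs
import Literature.NumberTheory.QuadraticFields.QuadraticDedekindZetaKronecker
import Literature.NumberTheory.QuadraticFields.IdealClassLatticeSums
import Literature.NumberTheory.QuadraticFields.ReducedFormLatticeSum
import Literature.NumberTheory.QuadraticFields.ClassNumberOneBakerInequality
import Literature.NumberTheory.LFunctions.PrimitiveQuadraticCharacterKronecker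
import Literature.NumberTheory.LFunctions.ExceptionalZeroLOneBound
import Literature.NumberTheory.EllipticCurves.HeegnerPointsImaginaryQuadraticProofs
import Mathlib.NumberTheory.LSeries.Injectivity
import HarnessLib

/-!
# Granville–Stark, Theorem 2 (abc.S22): uniform `abc` ⟹ no Siegel zeros, from the CM input ALONE

Topic `Literature/NumberTheory/DiophantineGeometry`; a proofs-only companion (theorems only, no
definitions, no named facts) of the named fact
`Literature.NumberTheory.DiophantineGeometry.granville_stark_noSiegelZeros :
UniformABCConjecture → NoSiegelZerosOddQuadratic` of `AbcWave0.lean` (A. Granville, H. M. Stark,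
*ABC implies no "Siegel zeros" for `L`-functions of characters with negative discriminant*,
Invent. Math. 139 (2000), **Theorem 2**).

## What is proved

`granville_stark_noSiegelZeros_of_cmInput` : **abc.S22 follows from ONE hypothesis `H`, the
complex-multiplication input of Granville–Stark's §2** — for every imaginary quadratic field `K`,
`D = d_K`, a number field `F ∋ g₂, g₃` (algebraic integers) with a complex embedding `ι`,
`ι(g₂³) = j(τ_D)`, `ι(g₃²) = j(τ_D) − 1728` (`j(τ_D) = formJ (principalForm D)`, the singular modulus
of the principal class: "an algebraic integer", GS p. 4, with (5) `j = γ₂³ = γ₃² + 1728`) and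
`|D_F| ≤ (6√|D|)^{[F:ℚ]}` (GS **Lemma 1**: `Δ_{k(γ₂,γ₃)} ≤ 6√d`, Shimura reciprocity and the
conductor–discriminant formula).  This `H` is LITERALLY the hypothesis of
`granville_stark_of_cmInput` (`AbcWave0GranvilleStarkTheorem1Proofs.lean`, the other seat's reduction
of Theorem 1 = `granville_stark`), so that a single proof of `H` now discharges BOTH abc.S22 records,
`granville_stark_holds` and `granville_stark_noSiegelZeros_holds`.  Compared with
`granville_stark_noSiegelZeros_of_lemma1Data_of_eq11` (`AbcWave0GranvilleStarkHeightProofs.lean`) the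
second, analytic hypothesis `eq11` (Granville–Stark (11): Kronecker's limit formula summed over the
classes, with the class number formula) is ELIMINATED: it is replaced by a proof.

## The proof (an elementary variant of GS §3 / Goldfeld–Schinzel)

Granville–Stark deduce Theorem 2 from Theorem 1 through (11)–(13) (`L'/L(1, χ) ≥ −C log d`, then
Mahler / §3.1).  We use instead the exceptional-zero inequality of the tree
(`RealChar.re_LFunction_one_le_of_zero`, Davenport Ch. 14: if `L(β, χ) = 0`, `0 < β < 1`, then
`L(1, χ) ≤ (1 − β) ∑_{n ≤ N} r(n)/n + 10q/⌊√N⌋`, `r = 1 ∗ χ`), which needs only UPPER bounds for the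
harmonic sums of `r(n)` — this is the route of Goldfeld–Schinzel, *On Siegel's zero* (1975), where
`∑_{(a,b,c)} 1/a` appears for the same reason.  For `χ` primitive quadratic odd mod `q`:

1. `χ` is the Kronecker character of the imaginary quadratic field `K` with `d_K = −q`
   (`PrimitiveQuadraticCharacterKronecker.lean`: `isFundamentalDiscriminant_neg`,
   `apply_natCast_eq_jacobiSym_neg_of_odd`; `exists_numberField_discr_eq`), hence
   `ζ_K = ζ · L(χ)` (`dedekindZeta_eq_riemannZeta_mul_LSeries_of_kronecker`, both parities of `q`)
   and `r(n) = a_K(n) = #{𝔞 : N𝔞 = n}` (`charDivisorSum_eq_card`, injectivity of `L`-series), and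
   `L(1, χ) = 2πh_K/(w√q) = πh(−q)/√q` (class number formula, `h(d_K) = h_K`, `w = 2` for `q > 4`);
2. `∑_{n ≤ N} a_K(n)/n ≤ ½ ∑_{Q reduced} [4/a_Q + (12 log N + 112)/√q]`
   (`sum_card_absNorm_eq_div_le` with the lattice bound `sum_inv_eval_le_of_mem_reducedForms`);
3. Theorem 1 in the `∑ 1/a` form, from uniform `abc` and `H`
   (`pi_mul_sqrt_mul_sum_inv_le_of_uniformABC`: `π√q ∑ 1/a_Q ≤ h(−q)(6.6 log q + C₀)`);
4. with `N = q⁴` and `1 − β < c/log q`, `c = 1/(29 log q… )`: `π ≤ (1 − β)(29 log q + C₁) + 10/√q < 2`, absurd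
   (`C₁ = |C₀| + 56`, `c = 1/(29 + C₁)`, `q ≥ 100`).
Large `q` suffice (`noSiegelZerosOddQuadratic_iff_eventually`).

## References

* A. Granville, H. M. Stark, Invent. Math. 139 (2000) 509–523: Theorems 1, 2; §2 Lemma 1, (5)–(7);
  §3 (11)–(13) (held copy `paper:galaxy-pdf-4469120640`). [GranvilleStark2000]
* D. M. Goldfeld, A. Schinzel, *On Siegel's zero*, Ann. Scuola Norm. Sup. Pisa (4) 2 (1975), 571–583.
* H. Davenport, *Multiplicative Number Theory*, 2nd ed. (1980), Ch. 6, Ch. 14. [DavenportMNT1980]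
-/

noncomputable section

open scoped NumberTheorySymbols
open NumberField Finset

namespace Literature.NumberTheory.DiophantineGeometry

open Literature.NumberTheory.QuadraticFields Literature.NumberTheory.QuadraticFields.Quadratic
open Literature.NumberTheory.QuadraticFields.BinaryQuadraticForm (reducedForms principalForm
  mem_reducedForms_iff principalForm_mem_reducedForms sum_inv_eval_le_of_mem_reducedForms)
open Literature.NumberTheory.EllipticCurves (IsImaginaryQuadratic formJ isImaginaryQuadratic_iff_discr_neg)
open Literature.NumberTheory.LFunctions Literature.NumberTheory.LFunctions.PrimitiveQuadratic

/-! ### The coefficients of `ζ(s) L(s, χ) = ζ_K(s)`: `r(n) = a_K(n)` -/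

/-- **`r(n) = (1 ∗ χ)(n)` is the number of ideals of norm `n`** when `ζ_K(s) = ζ(s) L(s, χ)` for
`Re s > 1`: both sides are `L`-series converging for `Re s > 1`
(`DirichletCharacter.LSeriesSummable_zetaMul`, `LSeriesSummable_dedekindZeta`), and `L`-series with
the same sum have the same coefficients (Mathlib `LSeries.eq_of_LSeries_eventually_eq`).  Davenport,
Ch. 6: `r(n) = ∑_{d ∣ n} χ(d)` counts ideals of norm `n`. [cite: DavenportMNT1980, Ch. 6] -/
theorem charDivisorSum_eq_card {K : Type*} [Field K] [NumberField K] {q : ℕ} [NeZero q]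
    {χ : DirichletCharacter ℂ q} (hq : χ ^ 2 = 1)
    (hζ : ∀ s : ℂ, 1 < s.re →
      NumberField.dedekindZeta K s = riemannZeta s * LSeries (fun n => χ n) s)
    {n : ℕ} (hn : n ≠ 0) :
    RealChar.charDivisorSum χ n = Nat.card {I : Ideal (𝓞 K) // Ideal.absNorm I = n} := by
  set f : ℕ → ℂ := fun n => (Nat.card {I : Ideal (𝓞 K) // Ideal.absNorm I = n} : ℂ) with hf
  set g : ℕ → ℂ := fun n => χ.zetaMul n with hg
  have h2 : (1 : ℝ) < (2 : ℂ).re := by norm_num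
  have hfa : LSeries.abscissaOfAbsConv f < ⊤ :=
    lt_of_le_of_lt (LSeriesSummable_dedekindZeta (K := K) h2).abscissaOfAbsConv_le (EReal.coe_lt_top _)
  have hga : LSeries.abscissaOfAbsConv g < ⊤ :=
    lt_of_le_of_lt (DirichletCharacter.LSeriesSummable_zetaMul χ h2).abscissaOfAbsConv_le
      (EReal.coe_lt_top _)
  -- `LSeries g s = ζ(s) L(s, χ)` for `Re s > 1`
  have hgL : ∀ s : ℂ, 1 < s.re → LSeries g s = riemannZeta s * LSeries (fun n => χ n) s := by
    intro s hs
    rw [hg, show (fun n : ℕ => (χ.zetaMul n : ℂ)) = ⇑χ.zetaMul from rfl, DirichletCharacter.zetaMul,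
      ← ArithmeticFunction.coe_mul, LSeries_convolution']
    · congr 1
      · simp_rw [← ArithmeticFunction.LSeries_zeta_eq_riemannZeta hs, ← ArithmeticFunction.natCoe_apply]
      · exact (LSeries_congr (χ.apply_eq_toArithmeticFunction_apply) s).symm
    · exact ArithmeticFunction.LSeriesSummable_zeta_iff.mpr hs
    · exact (LSeriesSummable_congr _ fun h ↦ (χ.apply_eq_toArithmeticFunction_apply h).symm).mpr <|
        ZMod.LSeriesSummable_of_one_lt_re χ hs
  have heq : (fun x : ℝ => LSeries f x) =ᶠ[Filter.atTop] fun x => LSeries g x := by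
    filter_upwards [Filter.eventually_gt_atTop 1] with x hx
    have hx' : 1 < (x : ℂ).re := by simpa using hx
    rw [hgL x hx', ← hζ x hx']
    rfl
  have hfg := LSeries.eq_of_LSeries_eventually_eq hfa hga heq hn
  simp only [hf, hg] at hfg
  have h := RealChar.ofReal_charDivisorSum χ hq n
  rw [← hfg] at h
  exact_mod_cast h

/-! ### The imaginary quadratic field of an odd real primitive character -/

/-- **The field of an odd primitive quadratic character.**  For `χ` primitive, quadratic and odd
mod `q` there is an imaginary quadratic field `K` with `d_K = −q` and `ζ_K(s) = ζ(s) L(s, χ)`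
(`Re s > 1`): `−q` is a fundamental discriminant (`isFundamentalDiscriminant_neg`), `K = ℚ(√−q)`
(`exists_numberField_discr_eq`), and `χ` has the Kronecker values `χ(p) = (−q / p)`, `χ(2) = ±1, 0`
(`apply_natCast_eq_jacobiSym_neg_of_odd`, `apply_two_*`), so
`dedekindZeta_eq_riemannZeta_mul_LSeries_of_kronecker` applies. [cite: DavenportMNT1980, Ch. 6] -/
theorem exists_imaginaryQuadratic_dedekindZeta_eq {q : ℕ} [NeZero q] {χ : DirichletCharacter ℂ q}
    (hprim : χ.IsPrimitive) (hquad : χ.IsQuadratic) (hodd : χ.Odd) :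
    ∃ (K : Type) (_ : Field K) (_ : NumberField K), IsImaginaryQuadratic K ∧
      NumberField.discr K = -(q : ℤ) ∧
      ∀ s : ℂ, 1 < s.re → NumberField.dedekindZeta K s = riemannZeta s * LSeries (fun n => χ n) s := by
  have hq0 : 0 < q := NeZero.pos q
  obtain ⟨K, _, _, h2, hdisc⟩ := exists_numberField_discr_eq (isFundamentalDiscriminant_neg hprim hquad hodd)
  have hneg : NumberField.discr K < 0 := by rw [hdisc]; omega
  refine ⟨K, inferInstance, inferInstance, isImaginaryQuadratic_iff_discr_neg.2 ⟨h2, hneg⟩, hdisc,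
    fun s hs => dedekindZeta_eq_riemannZeta_mul_LSeries_of_kronecker h2 χ ?_ ?_ hs⟩
  · intro p hp hp2
    rw [hdisc]
    exact apply_natCast_eq_jacobiSym_neg_of_odd hprim hquad hodd (hp.odd_of_ne_two hp2)
  · rw [hdisc]
    rcases Nat.even_or_odd q with hev | hqodd
    · obtain ⟨k, rfl⟩ := hev
      rw [apply_two_of_even ⟨k, rfl⟩ χ]
      have h1 : ¬ (-((k + k : ℕ) : ℤ)) % 8 = 1 := by omega
      have h5 : ¬ (-((k + k : ℕ) : ℤ)) % 8 = 5 := by omega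
      rw [if_neg h1, if_neg h5]
    · have hq3 := mod_four_eq_three_of_odd hqodd hprim hquad hodd
      by_cases h1 : (-(q : ℤ)) % 8 = 1
      · rw [if_pos h1, apply_two_eq_one_of_odd hqodd hprim hquad hodd h1]
      · have h5 : (-(q : ℤ)) % 8 = 5 := by omega
        rw [if_neg h1, if_pos h5, apply_two_eq_neg_one_of_odd hqodd hprim hquad hodd h5]

/-- `w_K = 2` for an imaginary quadratic field with `d_K < −4`. [cite: Cox2013, §7.A] -/
theorem torsionOrder_eq_two_of_discr_lt {K : Type*} [Field K] [NumberField K]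
    (h2 : Module.finrank ℚ K = 2) (hd : NumberField.discr K < -4) : Units.torsionOrder K = 2 := by
  obtain ⟨b, hb⟩ := exists_basis_zero_eq_one h2
  have hω := basis_one_mul_self_eq b hb
  have hDK := discr_eq_sq_add_four_mul b hb
  exact BakerLimitFormula.torsionOrder_eq_two b hb hω (by rw [← hDK]; exact hd)

/-! ### Theorem 2 from the CM input -/

/-- Real-power bookkeeping: `(6√d)^n = (36 d)^{n/2}`. [folklore] -/
theorem six_mul_sqrt_pow_eq {d : ℝ} (hd : 0 ≤ d) (n : ℕ) :
    (6 * Real.sqrt d) ^ n = (36 * d) ^ ((n : ℝ) / 2) := by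
  have hb : 0 ≤ 6 * Real.sqrt d := by positivity
  have h36 : (36 : ℝ) * d = (6 * Real.sqrt d) ^ (2 : ℝ) := by
    rw [Real.rpow_two, mul_pow, Real.sq_sqrt hd]; norm_num
  calc (6 * Real.sqrt d) ^ n = (6 * Real.sqrt d) ^ ((n : ℕ) : ℝ) := (Real.rpow_natCast _ n).symm
    _ = (6 * Real.sqrt d) ^ ((2 : ℝ) * ((n : ℝ) / 2)) := by congr 1; ring
    _ = ((6 * Real.sqrt d) ^ (2 : ℝ)) ^ ((n : ℝ) / 2) := Real.rpow_mul hb 2 _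
    _ = (36 * d) ^ ((n : ℝ) / 2) := by rw [h36]

/-- **Granville–Stark, Theorem 2 (abc.S22), from the CM input of their §2.**  Assume `H`: for
every imaginary quadratic field `K`, `D = d_K`, a number field `F` with an embedding `ι : F → ℂ`
and `g₂, g₃ ∈ 𝓞_F` with `ι(g₂³) = j(τ_D)`, `ι(g₃²) = j(τ_D) − 1728` ("`j(τ)` … is an algebraic
integer", `j = γ₂³ = γ₃² + 1728`) and `|D_F| ≤ (6√|D|)^{[F:ℚ]}` ("**Lemma 1.** … `Δ_K ≤ 6√d`") —
the same `H` as in `granville_stark_of_cmInput`.  Then the uniform `abc`-conjecture for number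
fields implies that the `L`-functions of odd real primitive characters have no Siegel zeros:
`granville_stark_noSiegelZeros` ("**Theorem 2.** The uniform abc-conjecture for number fields
implies that there are no "Siegel zeros" for any `(−d/·)` with `−d < 0`").  Proof: see the module
docstring (Theorem 1 with `∑ 1/a`, Dirichlet's class number formula, lattice sums class by class,
and the exceptional-zero inequality). [cite: GranvilleStark2000, Theorem 2 (with Theorem 1 and Lemma 1)] -/
theorem granville_stark_noSiegelZeros_of_cmInput
    (H : ∀ (K : Type) [Field K] [NumberField K], IsImaginaryQuadratic K →
      ∃ (F : Type) (_ : Field F) (_ : NumberField F) (ι : F →+* ℂ) (g₂ g₃ : 𝓞 F),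
        ι ((g₂ : F) ^ 3) = formJ (principalForm (NumberField.discr K)) ∧
        ι ((g₃ : F) ^ 2) = formJ (principalForm (NumberField.discr K)) - 1728 ∧
        |(NumberField.discr F : ℝ)| ≤ (6 * √|(NumberField.discr K : ℝ)|) ^ Module.finrank ℚ F) :
    granville_stark_noSiegelZeros := by
  intro habc
  classical
  -- Theorem 1 with `∑ 1/a`, `ε = 1/10` (`κ = 3(1+ε)/(1−5ε) = 33/5`)
  obtain ⟨C₀, hC₀⟩ := pi_mul_sqrt_mul_sum_inv_le_of_uniformABC habc (ε := 1 / 10) (by norm_num) (by norm_num)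
  have hκ : (3 * (1 + 1 / 10) / (1 - 5 * (1 / 10)) : ℝ) = 33 / 5 := by norm_num
  -- constants
  set C₁ : ℝ := |C₀| + 56 with hC₁
  have hC₁0 : 0 ≤ C₁ := by positivity
  set c : ℝ := 1 / (29 + C₁) with hc
  have hc0 : 0 < c := by positivity
  have hc1 : c ≤ 1 / 29 := one_div_le_one_div_of_le (by norm_num) (by linarith)
  -- large conductors suffice (`noSiegelZerosOddQuadratic_iff_eventually`, stated for the
  -- definitionally equal record `Summit.RiemannHypothesis.RiemannHypothesis.NoSiegelZerosOddQuadratic`)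
  refine noSiegelZerosOddQuadratic_iff_eventually.2
    ⟨c, hc0, 100, fun q _ hq χ hquad hprim hodd σ hσ hσ1 hzero => ?_⟩
  -- basic facts on `q`
  have hq100 : (100 : ℝ) ≤ q := by exact_mod_cast hq
  have hq0 : (0 : ℝ) < q := by linarith only [hq100]
  have hlogq : 1 ≤ Real.log q := by
    rw [← Real.log_exp 1]
    exact Real.log_le_log (Real.exp_pos 1) (by linarith only [hq100, Real.exp_one_lt_d9])
  have hsqrtq : 10 ≤ Real.sqrt q := by
    rw [show (10 : ℝ) = Real.sqrt 100 by rw [show (100 : ℝ) = 10 ^ 2 by norm_num, Real.sqrt_sq (by norm_num)]]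
    exact Real.sqrt_le_sqrt hq100
  have hsq0 : 0 < Real.sqrt q := by linarith only [hsqrtq]
  have hsq2 : Real.sqrt q ^ 2 = q := Real.sq_sqrt hq0.le
  -- `0 < σ < 1`
  have hσ0 : 0 < σ := by
    have : c / Real.log q ≤ 1 / 29 := by
      rw [div_le_iff₀ (by linarith only [hlogq])]
      nlinarith only [hc1, hlogq, hc0]
    linarith only [hσ, this]
  have h1σ : 1 - σ < c / Real.log q := by linarith only [hσ]
  /- 1. the field `K`, `d_K = -q`, `ζ_K = ζ L(χ)` -/
  obtain ⟨K, _, _, hK, hdisc, hζ⟩ := exists_imaginaryQuadratic_dedekindZeta_eq hprim hquad hodd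
  have h2 : Module.finrank ℚ K = 2 := hK.1
  have hneg : NumberField.discr K < 0 := hK.discr_neg
  have hD4 : NumberField.discr K % 4 = 0 ∨ NumberField.discr K % 4 = 1 := discr_emod_four h2
  have hlt4 : NumberField.discr K < -4 := by rw [hdisc]; omega
  have habsD : |(NumberField.discr K : ℝ)| = q := by
    rw [hdisc]; push_cast; rw [abs_neg, abs_of_nonneg hq0.le]
  have hnegD : -((NumberField.discr K : ℝ)) = q := by rw [hdisc]; push_cast; ring
  /- 2. the CM data and Theorem 1 -/
  obtain ⟨F, _, _, ι, g₂, g₃, hg₂, hg₃, hdF⟩ := H K hK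
  rw [map_pow] at hg₂ hg₃
  have hdF' : |(NumberField.discr F : ℝ)| ≤
      (36 * |(NumberField.discr K : ℝ)|) ^ ((Module.finrank ℚ F : ℝ) / 2) := by
    rw [← six_mul_sqrt_pow_eq (abs_nonneg _)]; exact hdF
  have hthm1 := hC₀ (NumberField.discr K) hneg hD4 F ι g₂ g₃ hg₂ hg₃ hdF'
  rw [hκ, hnegD] at hthm1
  -- `h(-q) ≥ 1`, `h(-q) = h_K`
  set h : ℕ := BinaryQuadraticForm.classNumber (NumberField.discr K) with hh
  have hh1 : (1 : ℝ) ≤ h := by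
    exact_mod_cast BinaryQuadraticForm.classNumber_pos hneg hD4
  have hhK : h = NumberField.classNumber K := card_reducedForms_eq_classNumber h2 hneg
  /- 3. class number formula: `Re L(1,χ) = π h / √q` -/
  have hq2 : 2 ≤ q := by omega
  have hχ1 : χ ≠ 1 := ne_one_of_isPrimitive_of_two_le hq2 hprim
  have hsq : χ ^ 2 = 1 := hquad.sq_eq_one
  have hw : Units.torsionOrder K = 2 := torsionOrder_eq_two_of_discr_lt h2 hlt4
  have hL1 : (χ.LFunction 1).re = Real.pi * h / Real.sqrt q := by
    rw [LFunction_one_eq_of_discr_neg_of_eq h2 hneg hχ1 (fun s hs => hζ s (by simpa using hs)),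
      Complex.ofReal_re, hw, ← hhK, habsD]
    push_cast
    ring
  /- 4. the exceptional-zero inequality with `N = q⁴` -/
  have hN1 : 1 ≤ q ^ 4 := Nat.one_le_pow _ _ (by omega)
  have hT3 := RealChar.re_LFunction_one_le_of_zero χ hχ1 hsq hσ0 hσ1 hzero hN1
  have hsqrtN : Nat.sqrt (q ^ 4) = q ^ 2 := by
    rw [show q ^ 4 = q ^ 2 * q ^ 2 by ring, Nat.sqrt_eq]
  rw [hsqrtN] at hT3
  have herr : (10 : ℝ) * q / ((q ^ 2 : ℕ) : ℝ) = 10 / q := by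
    push_cast
    field_simp
  rw [herr] at hT3
  /- 5. `∑_{n ≤ N} r(n)/n = ∑ a_K(n)/n ≤ ½ ∑_Q B(Q)` -/
  set N : ℕ := q ^ 4 with hN
  have hlogN : Real.log N = 4 * Real.log q := by
    rw [hN]; push_cast; rw [Real.log_pow]; push_cast; ring
  set B : ℤ × ℤ × ℤ → ℝ := fun Q => 4 / Q.1 + (12 * Real.log N + 112) / Real.sqrt q with hB
  have hS : ∑ n ∈ Ioc 0 N, RealChar.charDivisorSum χ n / n ≤
      (1 / 2) * ∑ Q ∈ reducedForms (NumberField.discr K), B Q := by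
    have hcoef : ∀ n ∈ Ioc 0 N, RealChar.charDivisorSum χ n / n =
        (Nat.card {I : Ideal (𝓞 K) // Ideal.absNorm I = n} : ℝ) / n := by
      intro n hn
      rw [charDivisorSum_eq_card hsq hζ (Nat.pos_iff_ne_zero.1 (mem_Ioc.1 hn).1)]
    rw [sum_congr rfl hcoef]
    refine sum_card_absNorm_eq_div_le hK N B fun Q hQ T hT => ?_
    have := sum_inv_eval_le_of_mem_reducedForms hneg hQ hN1 T hT
    rw [hnegD] at this
    exact this
  -- `∑_Q B(Q) = 4 ∑ 1/a + h (12 log N + 112)/√q`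
  have hsumB : ∑ Q ∈ reducedForms (NumberField.discr K), B Q =
      4 * ∑ Q ∈ reducedForms (NumberField.discr K), (1 : ℝ) / Q.1 +
        h * ((12 * Real.log N + 112) / Real.sqrt q) := by
    simp only [hB]
    rw [sum_add_distrib, sum_const, nsmul_eq_mul, mul_sum, hh, BinaryQuadraticForm.classNumber]
    congr 1
    exact sum_congr rfl fun Q _ => by ring
  /- 6. the contradiction -/
  set S₁ : ℝ := ∑ Q ∈ reducedForms (NumberField.discr K), (1 : ℝ) / Q.1 with hS₁
  set L : ℝ := Real.log q with hL
  set X : ℝ := (h : ℝ) / Real.sqrt q with hX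
  have hX0 : 0 < X := by positivity
  have hXq : 10 / (q : ℝ) ≤ X := by
    -- `10/q ≤ 1/√q ≤ h/√q`
    rw [hX, div_le_div_iff₀ hq0 hsq0]
    nlinarith only [mul_nonneg (sub_nonneg.2 hsqrtq) hsq0.le, mul_nonneg (sub_nonneg.2 hh1) hq0.le,
      hsq2, hh1, hsqrtq]
  -- (i) `π X ≤ (1 - σ)(2 S₁ + X (24 L + 56)) + 10/q`
  have hmain : Real.pi * X ≤ (1 - σ) * (2 * S₁ + X * (24 * L + 56)) + 10 / q := by
    have h1σ0 : 0 ≤ 1 - σ := by linarith only [hσ1]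
    have h1 : (χ.LFunction 1).re ≤
        (1 - σ) * ((1 / 2) * ∑ Q ∈ reducedForms (NumberField.discr K), B Q) + 10 / q :=
      hT3.trans (by linarith only [mul_le_mul_of_nonneg_left hS h1σ0])
    rw [hsumB, hlogN, hL1] at h1
    have e : (1 - σ) * ((1 / 2) * (4 * S₁ + h * ((12 * (4 * L) + 112) / Real.sqrt q))) =
        (1 - σ) * (2 * S₁ + X * (24 * L + 56)) := by
      rw [hX]; ring
    have e' : Real.pi * h / Real.sqrt q = Real.pi * X := by rw [hX]; ring
    linarith only [h1, e, e']
  -- (ii) Theorem 1: `2 S₁ ≤ X (5 L + |C₀|)`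
  have hS₁le : 2 * S₁ ≤ X * (5 * L + |C₀|) := by
    have hπ3 : (3 : ℝ) < Real.pi := Real.pi_gt_three
    have hthm1' : Real.pi * Real.sqrt q * S₁ ≤ h * (33 / 5 * L + C₀) := hthm1
    have hS₁0 : 0 ≤ S₁ := sum_nonneg fun Q hQ => by
      have : (0 : ℝ) < Q.1 := by exact_mod_cast ((mem_reducedForms_iff hneg).1 hQ).2.1
      positivity
    have habs : C₀ ≤ |C₀| := le_abs_self C₀
    have hh0 : (0 : ℝ) ≤ h := by linarith only [hh1]
    -- multiply the claim by `√q > 0`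
    rw [hX, div_mul_eq_mul_div, le_div_iff₀ hsq0]
    have a : 3 * (Real.sqrt q * S₁) ≤ Real.pi * Real.sqrt q * S₁ :=
      calc 3 * (Real.sqrt q * S₁) ≤ Real.pi * (Real.sqrt q * S₁) :=
            mul_le_mul_of_nonneg_right hπ3.le (mul_nonneg hsq0.le hS₁0)
        _ = Real.pi * Real.sqrt q * S₁ := by ring
    have b : Real.pi * Real.sqrt q * S₁ ≤ h * (33 / 5 * L + |C₀|) :=
      hthm1'.trans (mul_le_mul_of_nonneg_left (by linarith only [habs]) hh0)
    have hL0' : 0 ≤ (h : ℝ) * L := mul_nonneg hh0 (by linarith only [hlogq])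
    have hC0' : 0 ≤ (h : ℝ) * |C₀| := mul_nonneg hh0 (abs_nonneg C₀)
    have e1 : (h : ℝ) * (33 / 5 * L + |C₀|) = 33 / 5 * (h * L) + h * |C₀| := by ring
    have e2 : (h : ℝ) * (5 * L + |C₀|) = 5 * (h * L) + h * |C₀| := by ring
    rw [e2]
    rw [e1] at b
    linarith only [a, b, hL0', hC0']
  -- (iii) `π X ≤ (1 - σ) X (29 L + C₁) + 10/q`
  have h3 : Real.pi * X ≤ (1 - σ) * (X * (29 * L + C₁)) + 10 / q := by
    have h1σ0 : 0 ≤ 1 - σ := by linarith only [hσ1]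
    have : 2 * S₁ + X * (24 * L + 56) ≤ X * (29 * L + C₁) := by
      have e : X * (29 * L + C₁) = X * (5 * L + |C₀|) + X * (24 * L + 56) := by rw [hC₁]; ring
      rw [e]; linarith only [hS₁le]
    linarith only [hmain, mul_le_mul_of_nonneg_left this h1σ0]
  -- (iv) `(1 - σ)(29 L + C₁) < 1`
  have h4 : (1 - σ) * (29 * L + C₁) < 1 := by
    have hA0 : 0 < 29 * L + C₁ := by positivity
    have hL0 : 0 < L := by linarith only [hlogq]
    calc (1 - σ) * (29 * L + C₁) < c / L * (29 * L + C₁) := mul_lt_mul_of_pos_right h1σ hA0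
      _ = c * (29 + C₁ / L) := by field_simp
      _ ≤ c * (29 + C₁) := by
          refine mul_le_mul_of_nonneg_left ?_ hc0.le
          have : C₁ / L ≤ C₁ := div_le_self hC₁0 hlogq
          linarith only [this]
      _ = 1 := by rw [hc, one_div, inv_mul_cancel₀ (by positivity)]
  -- (v) `π X < 2 X` (`10/q ≤ X`)
  have h5 : Real.pi * X < 2 * X := by
    have e : (1 - σ) * (X * (29 * L + C₁)) = X * ((1 - σ) * (29 * L + C₁)) := by ring
    have : X * ((1 - σ) * (29 * L + C₁)) < X * 1 := mul_lt_mul_of_pos_left h4 hX0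
    linarith only [h3, e, this, hXq]
  have : Real.pi < 2 := lt_of_mul_lt_mul_right h5 hX0.le
  linarith only [this, Real.pi_gt_three]

/-- **Both abc.S22 records from the single CM input.**  The hypothesis `H` (integrality of the
singular modulus `j(τ_D)` together with Granville–Stark's Lemma 1, `Δ_{k(γ₂,γ₃)} ≤ 6√d`) implies
BOTH named facts of `AbcWave0.lean` attached to Granville–Stark 2000: Theorem 1
(`granville_stark`, via `granville_stark_of_cmInput`, `AbcWave0GranvilleStarkTheorem1Proofs.lean`) and
Theorem 2 (`granville_stark_noSiegelZeros`, via `granville_stark_noSiegelZeros_of_cmInput`).  What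
remains for `granville_stark_holds` and `granville_stark_noSiegelZeros_holds` is therefore exactly one
proof of `H` — complex multiplication / class field theory for `ℚ(√−d)` (Cox, Thm. 11.1; Shimura
reciprocity, the ray class field mod `6`, the conductor–discriminant formula), absent from Mathlib
and the tree. [cite: GranvilleStark2000, Theorems 1 and 2 (with Lemma 1)] -/
theorem granville_stark_and_noSiegelZeros_of_cmInput
    (H : ∀ (K : Type) [Field K] [NumberField K], IsImaginaryQuadratic K →
      ∃ (F : Type) (_ : Field F) (_ : NumberField F) (ι : F →+* ℂ) (g₂ g₃ : 𝓞 F),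
        ι ((g₂ : F) ^ 3) = formJ (principalForm (NumberField.discr K)) ∧
        ι ((g₃ : F) ^ 2) = formJ (principalForm (NumberField.discr K)) - 1728 ∧
        |(NumberField.discr F : ℝ)| ≤ (6 * √|(NumberField.discr K : ℝ)|) ^ Module.finrank ℚ F) :
    granville_stark ∧ granville_stark_noSiegelZeros :=
  ⟨granville_stark_of_cmInput H, granville_stark_noSiegelZeros_of_cmInput H⟩

end Literature.NumberTheory.DiophantineGeometry

end
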